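import Literature.Analysis.FluidPDE.MikadoShiftedPipes
import Literature.Analysis.FluidPDE.Antidivergence
import Literature.Analysis.FluidPDE.AlexakisDoeringProofs
import Literature.Analysis.FunctionSpaces.TorusInverseLaplacianCalculus
import Literature.Analysis.FunctionSpaces.TorusInverseLaplacianL2
import HarnessLib

/-!
# Rescaled Mikado building blocks `ψ_x(σ·)`, their potentials, and size bounds

Analysis/FluidPDE support file (all results proved; definitions are explicit constructions) for
the proof of Prop. 4.1 of A. Cheskidov, X. Luo, *Sharp nonuniqueness for the Navier–Stokes
equations*, Invent. Math. 229 (2022) = arXiv:2009.06596, §4 (numbering of the held arXiv copy).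
It packages what the perturbation `w = w^{(p)} + w^{(c)} + w^{(t)}` of §4.4 and the stress
algebra of §4.5 need about the spatial building blocks of `MikadoFlows` after the oscillation
rescaling `y ↦ σ • y`, `σ ∈ ℕ` (CL22 (4.16): "`𝐖_k(σx)`"):

* calculus of `y ↦ f(σ • y)` along a pipe direction: `dirD x f = ∑ⱼ (k_x)ⱼ ∂ⱼ f` (the
  derivative `(k_x·∇)f`), its product rule, and `(k_x·∇)ψ_x = 0`, `(k_x·∇)∂ᵢφ_x = 0`
  (CL22 Thm. 4.3 (1): the profiles depend on `x` only through `dist(x, l_k)`);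
* the rescaled profile `psiR x μ σ = ψ_x(σ·)`, the rescaled potentials
  `phiR = σ⁻² φ_x(σ·)` with `Δ phiR = psiR` and `thetaR j = σ⁻³ (∂ⱼΘ_x)(σ·)` with
  `Δ (thetaR j) = ∂ⱼ phiR` (the two "layers" of potentials used to expand `∂ₜw^{(p)}`; CL22
  (4.7) `ψ_k = Δφ_k` and §4.5, here one level deeper), and the oscillation potential
  `oscPot = σ⁻² (Δ⁻¹(ψ_x² - 1))(σ·)` with `Δ oscPot = psiR² - 1` (CL22 §4.5, the term
  `𝓑(∇a_k², 𝐖_k ⊗ 𝐖_k(σ·) - ⨍)`, here through `Δ⁻¹` of `TorusInverseLaplacian`);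
* **size bounds** (CL22 Thm. 4.3 (2): `μ^{-m}‖∇^m ψ_k‖_p ≲ μ^{(d-1)(1/2-1/p)}`): the predicate
  `IsConc a P` ("the `μ`-family `P μ` is concentrated of order `a`": `|P μ| ≤ C μ^a` and
  `‖P μ‖_{L^p} ≤ C μ^{a-(d-1)/p}` for `1 ≤ p ≤ 2`, `μ ≥ 1`), closed under sums and constant
  multiples, holding for pulled-back concentrated profiles (exact scaling,
  `Mikado.integral_abs_pull_conc_rpow`), hence for `ψ_x` (`a = (d-1)/2`), `∂ψ_x` (`a + 1`),
  `∂φ_x` (`a - 1`), `∂∂φ_x` (`a`), `∂∂Θ_x` (`a - 2`); invariance of sup and `L^p` norms under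
  `y ↦ σ • y` (Haar invariance, `measurePreserving_nsmul_unitAddTorus`);
* the **Green pairing** `∫ b · F(σ·) = σ⁻² ∫ Δb · (Δ⁻¹F)(σ·)` for zero-mean `F` (the
  `p = 2` replacement of CL22 Lemma 7.1 / Thm. 7.4 used in the energy estimate Prop. 5.3), and
  `∫ (ψ_x² - 1)² ≤ (sup|ψ_x|)²`.

## Mathlib / tree search

Reused: `lineDeriv_comp_nsmul`, `partialDeriv_comp_nsmul`, `isSmooth_comp_nsmul`,
`partialDeriv_partialDeriv_comp_nsmul`, `laplacian_comp_nsmul` (`AlexakisDoeringProofs`),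
`measurePreserving_nsmul_unitAddTorus`, `integral_comp_nsmul` (`ZerothLawProofs`),
`Mikado.psi/phi/theta`, `partialDeriv_pull_conc`, `abs_pull_conc_le`,
`integral_abs_pull_conc_rpow`, `fderiv_psi_dirVec` (`MikadoFlows`), `fderiv_partialDeriv_pull_dir`
(`MikadoShiftedPipes`), `TransverseDatum.partialDeriv_pull` (`TransversePullback`), `Torus.invLaplacian`, `laplacian_invLaplacian`,
`partialDeriv_laplacian_comm`, `partialDeriv_invLaplacian` (`TorusInverseLaplacian(Calculus)`),
`integral_sq_invLaplacian_le`, `integral_sq_partialDeriv_invLaplacian_le`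
(`TorusInverseLaplacianL2`), `integral_mul_laplacian_comm_holds` (`TorusCalculusProofs`),
Mathlib `MemLp.eLpNorm_eq_integral_rpow_norm`, `eLpNorm_comp_measurePreserving`,
`integral_mul_le_Lp_mul_Lq_of_nonneg`. `lean search 'psiR|phiR|thetaR|oscPot|IsConc|dirD '`
finds no prior versions.

## References

* A. Cheskidov, X. Luo, arXiv:2009.06596, §4.1 Thm. 4.3, (4.5)–(4.7), §4.4 (4.16)–(4.18),
  §4.5, §7.2, Lemma 7.1, Thm. 7.4. [`CheskidovLuo2022`]
-/

noncomputable section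

open Set Filter Topology Function MeasureTheory Finset
open scoped ContDiff ENNReal

namespace Literature.Analysis.FluidPDE

namespace Mikado

open FunctionSpaces NashGeometric Transverse

variable {d : Type*} [Fintype d] [DecidableEq d]

/-! ## Calculus of `y ↦ f (σ • y)` and of the pipe derivative `(k_x·∇)` -/

section Calculus

variable {f g : UnitAddTorus d → ℝ}

omit [DecidableEq d] in
/-- Chain rule for the torus Fréchet derivative under `y ↦ n • y` (smooth `f`):
`D(f(n•·))(y) v = n Df(n•y) v`. [folklore] -/
theorem fderiv_comp_nsmul {F : Type*} [NormedAddCommGroup F] [NormedSpace ℝ F] {f : UnitAddTorus d → F}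
    (hf : Torus.IsSmooth f) (n : ℕ) (y : UnitAddTorus d) (v : EuclideanSpace ℝ d) :
    Torus.fderiv (fun z => f (n • z)) y v = (n : ℝ) • Torus.fderiv f (n • y) v := by
  rw [← Torus.lineDeriv_eq_fderiv_apply ((isSmooth_comp_nsmul hf n).isContDiff (by simp)),
    ← Torus.lineDeriv_eq_fderiv_apply (hf.isContDiff (by simp)), lineDeriv_comp_nsmul]

omit [DecidableEq d] in
/-- The gradient under `y ↦ n • y`: `∇(f(n•·))(y) = n ∇f(n•y)`. [folklore] -/
theorem gradient_comp_nsmul (hf : Torus.IsSmooth f) (n : ℕ) (y : UnitAddTorus d) :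
    Torus.gradient (fun z => f (n • z)) y = (n : ℝ) • Torus.gradient f (n • y) := by
  refine ext_inner_right ℝ fun w => ?_
  rw [Torus.inner_gradient_left, inner_smul_left, Torus.inner_gradient_left, fderiv_comp_nsmul hf n y w]
  simp

/-- **The pipe derivative** `(k_x·∇)f (y) = ∑ⱼ (k_x)ⱼ ∂ⱼf(y)` of a scalar function along the
direction `k_x` of the geometric lemma. [folklore] -/
def dirD (x : Index d) (f : UnitAddTorus d → ℝ) (y : UnitAddTorus d) : ℝ :=
  ∑ j, ((dir x j : ℤ) : ℝ) * Torus.partialDeriv j f y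

/-- `(k_x·∇)f = Df · k_x` for `C¹` functions. [folklore] -/
theorem dirD_eq_fderiv (x : Index d) (hf : Torus.IsContDiff 1 f) (y : UnitAddTorus d) :
    dirD x f y = Torus.fderiv f y (dirVec x) := by
  rw [dirD, Torus.fderiv_apply_eq_sum_partialDeriv hf]
  exact Finset.sum_congr rfl fun j _ => by simp [dirVec]

/-- Product rule for the pipe derivative. [folklore] -/
theorem dirD_mul (x : Index d) (hf : Torus.IsContDiff 1 f) (hg : Torus.IsContDiff 1 g) (y : UnitAddTorus d) :
    dirD x (fun z => f z * g z) y = f y * dirD x g y + g y * dirD x f y := by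
  simp only [dirD, Torus.partialDeriv_mul hf hg, mul_add, Finset.sum_add_distrib, Finset.mul_sum]
  congr 1 <;> exact Finset.sum_congr rfl fun j _ => by ring

/-- The pipe derivative is homogeneous. [folklore] -/
theorem dirD_const_mul (x : Index d) (hf : Torus.IsContDiff 1 f) (c : ℝ) (y : UnitAddTorus d) :
    dirD x (fun z => c * f z) y = c * dirD x f y := by
  simp only [dirD, Torus.partialDeriv_const_mul_apply hf, Finset.mul_sum]
  exact Finset.sum_congr rfl fun j _ => by ring

/-- The pipe derivative of a constant vanishes. [folklore] -/
theorem dirD_const (x : Index d) (c : ℝ) (y : UnitAddTorus d) : dirD x (fun _ => c) y = 0 := by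
  simp [dirD, Torus.partialDeriv_const_apply]

/-- The pipe derivative under `y ↦ n • y`. [folklore] -/
theorem dirD_comp_nsmul (x : Index d) (f : UnitAddTorus d → ℝ) (n : ℕ) (y : UnitAddTorus d) :
    dirD x (fun z => f (n • z)) y = (n : ℝ) * dirD x f (n • y) := by
  simp only [dirD, partialDeriv_comp_nsmul, smul_eq_mul, Finset.mul_sum]
  exact Finset.sum_congr rfl fun j _ => by ring

variable {μ : ℝ}

/-- **`(k_x·∇)ψ_x = 0`** (CL22 Thm. 4.3 (1)). [cite: CheskidovLuo2022, Thm. 4.3 (1)] -/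
theorem dirD_psi (x : Index d) (hμ : 1 ≤ μ) (y : UnitAddTorus d) : dirD x (psi x μ) y = 0 := by
  rw [dirD_eq_fderiv x ((isSmooth_psi x hμ).isContDiff (by simp)), fderiv_psi_dirVec x hμ]

/-- `(k_x·∇)φ_x = 0`. [folklore] -/
theorem dirD_phi (x : Index d) (hμ : 1 ≤ μ) (y : UnitAddTorus d) : dirD x (phi x μ) y = 0 := by
  rw [dirD_eq_fderiv x ((isSmooth_phi x hμ).isContDiff (by simp)), fderiv_phi_dirVec x hμ]

/-- **`(k_x·∇)∂ᵢφ_x = 0`**: the partial derivatives of the potential are again pull-backs along the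
same transverse map (`Mikado.fderiv_partialDeriv_pull_dir`). [folklore] -/
theorem dirD_partialDeriv_phi (x : Index d) (hμ : 1 ≤ μ) (i : d) (y : UnitAddTorus d) :
    dirD x (Torus.partialDeriv i (phi x μ)) y = 0 := by
  have h1 : Torus.IsContDiff 1 (Torus.partialDeriv i (phi x μ)) := ((isSmooth_phi x hμ).partialDeriv i).isContDiff (by simp)
  rw [dirD_eq_fderiv x h1]
  have h := fderiv_partialDeriv_pull_dir (datum x) (isSmooth_phiT (datum x).c hμ) i y
  rwa [datum_k] at h

end Calculus

/-! ## Concentrated families: sup and `L^p` size -/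

section Conc

variable (d) in
/-- **A `μ`-family `P μ : 𝕋^d → ℝ` is concentrated of order `a`**: each `P μ` is continuous and,
for `μ ≥ 1`, `|P μ| ≤ C μ^a` pointwise and `‖P μ‖_{L^p(𝕋^d)} ≤ C μ^{a - (d-1)/p}` for
`1 ≤ p ≤ 2`, with one constant `C` — the shape of CL22 Thm. 4.3 (2),
`μ^{-m}‖∇^m ψ_k‖_{L^p} ≲ μ^{(d-1)(1/2 - 1/p)}` (order `a = (d-1)/2 + m` for `∇^m ψ_k`).
[cite: CheskidovLuo2022, Thm. 4.3 (2)] -/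
def IsConc (a : ℝ) (P : ℝ → UnitAddTorus d → ℝ) : Prop :=
  (∀ μ, 1 ≤ μ → Continuous (P μ)) ∧
    ∃ C, 0 ≤ C ∧ ∀ μ, 1 ≤ μ → (∀ y, |P μ y| ≤ C * μ ^ a) ∧
      ∀ p : ℝ, 1 ≤ p → p ≤ 2 →
        eLpNorm (P μ) (ENNReal.ofReal p) volume ≤ ENNReal.ofReal (C * μ ^ (a - ((Fintype.card d : ℝ) - 1) / p))

variable {a b : ℝ} {P Q : ℝ → UnitAddTorus d → ℝ}

omit [DecidableEq d] in
/-- The zero family is concentrated of every order. [folklore] -/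
theorem isConc_zero (a : ℝ) : IsConc d a (fun _ _ => 0) := by
  refine ⟨fun _ _ => continuous_const, 0, le_rfl, fun μ _ => ⟨fun y => by simp, fun p _ _ => ?_⟩⟩
  simp

omit [DecidableEq d] in
/-- Sums of concentrated families of the same order are concentrated. [folklore] -/
theorem IsConc.add (hP : IsConc d a P) (hQ : IsConc d a Q) : IsConc d a (fun μ y => P μ y + Q μ y) := by
  obtain ⟨hPc, C, hC, hP⟩ := hP
  obtain ⟨hQc, D, hD, hQ⟩ := hQ
  refine ⟨fun μ hμ => (hPc μ hμ).add (hQc μ hμ), C + D, by positivity, fun μ hμ => ⟨fun y => ?_, fun p hp hp2 => ?_⟩⟩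
  · have h1 := (hP μ hμ).1 y
    have h2 := (hQ μ hμ).1 y
    calc |P μ y + Q μ y| ≤ |P μ y| + |Q μ y| := abs_add_le _ _
      _ ≤ C * μ ^ a + D * μ ^ a := add_le_add h1 h2
      _ = (C + D) * μ ^ a := by ring
  · have hμ0 : 0 ≤ μ := by linarith
    have h1 := (hP μ hμ).2 p hp hp2
    have h2 := (hQ μ hμ).2 p hp hp2
    have hp1 : (1 : ℝ≥0∞) ≤ ENNReal.ofReal p := by rw [← ENNReal.ofReal_one]; exact ENNReal.ofReal_le_ofReal hp
    calc eLpNorm (fun y => P μ y + Q μ y) (ENNReal.ofReal p) volume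
        ≤ eLpNorm (P μ) (ENNReal.ofReal p) volume + eLpNorm (Q μ) (ENNReal.ofReal p) volume :=
          eLpNorm_add_le (hPc μ hμ).aestronglyMeasurable (hQc μ hμ).aestronglyMeasurable hp1
      _ ≤ ENNReal.ofReal (C * μ ^ (a - ((Fintype.card d : ℝ) - 1) / p)) +
            ENNReal.ofReal (D * μ ^ (a - ((Fintype.card d : ℝ) - 1) / p)) := add_le_add h1 h2
      _ = ENNReal.ofReal ((C + D) * μ ^ (a - ((Fintype.card d : ℝ) - 1) / p)) := by
          rw [← ENNReal.ofReal_add (by positivity) (by positivity)]; ring_nf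

omit [DecidableEq d] in
/-- Constant multiples of concentrated families are concentrated. [folklore] -/
theorem IsConc.const_mul (hP : IsConc d a P) (c : ℝ) : IsConc d a (fun μ y => c * P μ y) := by
  obtain ⟨hPc, C, hC, hP⟩ := hP
  refine ⟨fun μ hμ => continuous_const.mul (hPc μ hμ), |c| * C, by positivity, fun μ hμ => ⟨fun y => ?_, fun p hp hp2 => ?_⟩⟩
  · rw [abs_mul, mul_assoc]
    exact mul_le_mul_of_nonneg_left ((hP μ hμ).1 y) (abs_nonneg c)
  · have h1 := (hP μ hμ).2 p hp hp2
    have e : (fun y => c * P μ y) = c • P μ := rfl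
    show eLpNorm (fun y => c * P μ y) _ _ ≤ _
    rw [e, eLpNorm_const_smul, mul_assoc, ENNReal.ofReal_mul (abs_nonneg c), ← Real.enorm_eq_ofReal_abs]
    gcongr

omit [DecidableEq d] in
/-- Finite sums of concentrated families of the same order are concentrated. [folklore] -/
theorem IsConc.sum {ι : Type*} (s : Finset ι) {P : ι → ℝ → UnitAddTorus d → ℝ} (h : ∀ i ∈ s, IsConc d a (P i)) :
    IsConc d a (fun μ y => ∑ i ∈ s, P i μ y) := by
  classical
  induction s using Finset.induction_on with
  | empty => simpa using isConc_zero (d := d) a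
  | insert i s hi ih =>
    have h1 := (h i (Finset.mem_insert_self i s)).add (ih fun j hj => h j (Finset.mem_insert_of_mem hj))
    simpa only [Finset.sum_insert hi] using h1

omit [DecidableEq d] in
/-- Raising the order (`μ ≥ 1`). [folklore] -/
theorem IsConc.of_le (hP : IsConc d a P) (hab : a ≤ b) : IsConc d b P := by
  obtain ⟨hPc, C, hC, hP⟩ := hP
  refine ⟨hPc, C, hC, fun μ hμ => ⟨fun y => ((hP μ hμ).1 y).trans ?_, fun p hp hp2 => ((hP μ hμ).2 p hp hp2).trans ?_⟩⟩
  · exact mul_le_mul_of_nonneg_left (Real.rpow_le_rpow_of_exponent_le hμ hab) hC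
  · exact ENNReal.ofReal_le_ofReal (mul_le_mul_of_nonneg_left
      (Real.rpow_le_rpow_of_exponent_le hμ (by linarith)) hC)

omit [DecidableEq d] in
/-- The continuity clause. [folklore] -/
theorem IsConc.continuous (hP : IsConc d a P) {μ : ℝ} (hμ : 1 ≤ μ) : Continuous (P μ) := hP.1 μ hμ

omit [DecidableEq d] in
/-- The sup clause. [folklore] -/
theorem IsConc.exists_sup (hP : IsConc d a P) :
    ∃ C, 0 ≤ C ∧ ∀ μ, 1 ≤ μ → ∀ y, |P μ y| ≤ C * μ ^ a := by
  obtain ⟨-, C, hC, hP⟩ := hP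
  exact ⟨C, hC, fun μ hμ => (hP μ hμ).1⟩

omit [DecidableEq d] in
/-- The `L^p` clause. [folklore] -/
theorem IsConc.exists_eLpNorm (hP : IsConc d a P) :
    ∃ C, 0 ≤ C ∧ ∀ μ, 1 ≤ μ → ∀ p : ℝ, 1 ≤ p → p ≤ 2 →
      eLpNorm (P μ) (ENNReal.ofReal p) volume ≤ ENNReal.ofReal (C * μ ^ (a - ((Fintype.card d : ℝ) - 1) / p)) := by
  obtain ⟨-, C, hC, hP⟩ := hP
  exact ⟨C, hC, fun μ hμ => (hP μ hμ).2⟩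

/-! ### The base case: pulled-back concentrated profiles -/

/-- `|z|^p ≤ |z| + z²` for `1 ≤ p ≤ 2`. [folklore] -/
theorem abs_rpow_le_abs_add_sq (z : ℝ) {p : ℝ} (hp : 1 ≤ p) (hp2 : p ≤ 2) : |z| ^ p ≤ |z| + z ^ 2 := by
  rcases le_or_gt (|z|) 1 with h | h
  · have h1 : |z| ^ p ≤ |z| ^ (1 : ℝ) := by
      rcases (abs_nonneg z).eq_or_lt with h0 | h0
      · rw [← h0, Real.zero_rpow (by linarith), Real.zero_rpow one_ne_zero]
      · exact Real.rpow_le_rpow_of_exponent_ge h0 h hp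
    rw [Real.rpow_one] at h1
    nlinarith [sq_nonneg z]
  · have h1 : |z| ^ p ≤ |z| ^ (2 : ℝ) := Real.rpow_le_rpow_of_exponent_le h.le hp2
    rw [Real.rpow_two, sq_abs] at h1
    linarith [abs_nonneg z]

/-- For a compactly supported smooth `f₀` and `1 ≤ p ≤ 2`:
`(∫ |f₀|^p)^{1/p} ≤ max 1 (∫|f₀| + ∫f₀²)`. [folklore] -/
theorem rpow_integral_abs_rpow_le {m : Type*} [Fintype m] {f₀ : EuclideanSpace ℝ m → ℝ}
    (hf : ContDiff ℝ ∞ f₀) (hfs : HasCompactSupport f₀) {p : ℝ} (hp : 1 ≤ p) (hp2 : p ≤ 2) :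
    (∫ z, |f₀ z| ^ p) ^ (1 / p) ≤ max 1 ((∫ z, |f₀ z|) + ∫ z, f₀ z ^ 2) := by
  have hp0 : 0 < p := by linarith
  have hc : Continuous f₀ := hf.continuous
  have hi1 : Integrable (fun z => |f₀ z|) volume := (hc.integrable_of_hasCompactSupport hfs).abs
  have hs2 : HasCompactSupport (fun z => f₀ z ^ 2) := hfs.comp_left (g := fun t : ℝ => t ^ 2) (zero_pow two_ne_zero)
  have hi2 : Integrable (fun z => f₀ z ^ 2) volume := (hc.pow 2).integrable_of_hasCompactSupport hs2
  have hsp : HasCompactSupport (fun z => |f₀ z| ^ p) :=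
    hfs.comp_left (g := fun t : ℝ => |t| ^ p) (by simp [Real.zero_rpow hp0.ne'])
  have hip : Integrable (fun z => |f₀ z| ^ p) volume :=
    (hc.abs.rpow_const fun _ => Or.inr hp0.le).integrable_of_hasCompactSupport hsp
  have hle : ∫ z, |f₀ z| ^ p ≤ (∫ z, |f₀ z|) + ∫ z, f₀ z ^ 2 := by
    rw [← integral_add hi1 hi2]
    exact integral_mono hip (hi1.add hi2) fun z => abs_rpow_le_abs_add_sq (f₀ z) hp hp2
  have hI0 : 0 ≤ ∫ z, |f₀ z| ^ p := integral_nonneg fun _ => Real.rpow_nonneg (abs_nonneg _) _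
  have hp0' : 0 ≤ 1 / p := by positivity
  have hp1 : 1 / p ≤ 1 := by rw [div_le_one hp0]; exact hp
  rcases le_or_gt ((∫ z, |f₀ z|) + ∫ z, f₀ z ^ 2) 1 with hN1 | hN1
  · exact (Real.rpow_le_one hI0 (hle.trans hN1) hp0').trans (le_max_left _ _)
  · calc (∫ z, |f₀ z| ^ p) ^ (1 / p) ≤ ((∫ z, |f₀ z|) + ∫ z, f₀ z ^ 2) ^ (1 / p) := Real.rpow_le_rpow hI0 hle hp0'
      _ ≤ ((∫ z, |f₀ z|) + ∫ z, f₀ z ^ 2) ^ (1 : ℝ) := Real.rpow_le_rpow_of_exponent_le hN1.le hp1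
      _ = (∫ z, |f₀ z|) + ∫ z, f₀ z ^ 2 := Real.rpow_one _
      _ ≤ _ := le_max_right _ _

omit [DecidableEq d] in
/-- `L^p` norms of continuous functions on the torus through real integrals (`1 ≤ p`). [folklore] -/
theorem eLpNorm_eq_ofReal_rpow_integral {f : UnitAddTorus d → ℝ} (hf : Continuous f) {p : ℝ} (hp : 1 ≤ p) :
    eLpNorm f (ENNReal.ofReal p) volume = ENNReal.ofReal ((∫ y, |f y| ^ p) ^ (1 / p)) := by
  have hp0 : 0 < p := by linarith
  obtain ⟨B, hB⟩ := (isCompact_univ.image hf).isBounded.exists_norm_le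
  have hmem : MemLp f (ENNReal.ofReal p) volume :=
    (memLp_top_of_bound hf.aestronglyMeasurable B (Eventually.of_forall fun y => hB _ ⟨y, mem_univ _, rfl⟩)).mono_exponent
      le_top
  rw [hmem.eLpNorm_eq_integral_rpow_norm (by simp [hp0]) ENNReal.ofReal_ne_top, ENNReal.toReal_ofReal hp0.le,
    one_div]
  simp [Real.norm_eq_abs]

/-- **Pulled-back concentrated profiles are concentrated of their amplitude order**:
`|conc ∘ L| ≤ |κ₀| μ^a sup|f₀|` and `‖conc ∘ L‖_{L^p(𝕋^d)} = |κ₀| μ^{a-(d-1)/p} ‖f₀‖_{L^p}`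
(`m = d - 1` transverse variables; CL22 Thm. 4.3 (2)). [cite: CheskidovLuo2022, Thm. 4.3 (2)] -/
theorem isConc_pull_conc (x : Index d) {f₀ : EuclideanSpace ℝ (Slot x) → ℝ} (hf : IsProfile f₀) (κ₀ a : ℝ) :
    IsConc d a (fun μ => (datum x).pull (conc κ₀ a μ f₀)) := by
  obtain ⟨B, hB0, hB⟩ := hf.exists_bound
  set N := (∫ z, |f₀ z|) + ∫ z, f₀ z ^ 2 with hN
  have hN0 : 0 ≤ N := by rw [hN]; positivity
  have hm : (Fintype.card (Slot x) : ℝ) = (Fintype.card d : ℝ) - 1 := by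
    rw [card_slot]
    have : 1 ≤ Fintype.card d := Fintype.card_pos_iff.2 ⟨pivot x⟩
    push_cast [Nat.cast_sub this]; ring
  refine ⟨fun μ hμ => (isSmooth_pull_conc (datum x) hf hμ κ₀ a).continuous, |κ₀| * (B + max 1 N), by positivity,
    fun μ hμ => ⟨fun y => ?_, fun p hp hp2 => ?_⟩⟩
  · have hμ0 : 0 ≤ μ := by linarith
    calc |(datum x).pull (conc κ₀ a μ f₀) y| ≤ |κ₀| * μ ^ a * B := abs_pull_conc_le (datum x) hf hμ hB κ₀ a y
      _ ≤ |κ₀| * μ ^ a * (B + max 1 N) := by gcongr; linarith [le_max_left (1 : ℝ) N]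
      _ = |κ₀| * (B + max 1 N) * μ ^ a := by ring
  · have hμ0 : 0 < μ := by linarith
    have hp0 : 0 < p := by linarith
    rw [eLpNorm_eq_ofReal_rpow_integral (isSmooth_pull_conc (datum x) hf hμ κ₀ a).continuous hp,
      integral_abs_pull_conc_rpow (datum x) hf hμ κ₀ a hp0, hm]
    refine ENNReal.ofReal_le_ofReal ?_
    have hI0 : 0 ≤ ∫ z, |f₀ z| ^ p := integral_nonneg fun _ => Real.rpow_nonneg (abs_nonneg _) _
    rw [Real.mul_rpow (by positivity) hI0, Real.mul_rpow (by positivity) (by positivity),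
      ← Real.rpow_mul (abs_nonneg κ₀), ← Real.rpow_mul hμ0.le, mul_one_div_cancel hp0.ne', Real.rpow_one,
      show (a * p - ((Fintype.card d : ℝ) - 1)) * (1 / p) = a - ((Fintype.card d : ℝ) - 1) / p by field_simp]
    have hf2 := rpow_integral_abs_rpow_le hf.smooth hf.hasCompactSupport hp hp2
    rw [← hN] at hf2
    calc |κ₀| * μ ^ (a - ((Fintype.card d : ℝ) - 1) / p) * (∫ z, |f₀ z| ^ p) ^ (1 / p)
        ≤ |κ₀| * μ ^ (a - ((Fintype.card d : ℝ) - 1) / p) * (B + max 1 N) := by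
          gcongr; linarith
      _ = |κ₀| * (B + max 1 N) * μ ^ (a - ((Fintype.card d : ℝ) - 1) / p) := by ring

omit [DecidableEq d] in
/-- Changing the family at `μ ≥ 1` only. [folklore] -/
theorem IsConc.congr (hP : IsConc d a P) (h : ∀ μ, 1 ≤ μ → P μ = Q μ) : IsConc d a Q := by
  obtain ⟨hPc, C, hC, hP⟩ := hP
  refine ⟨fun μ hμ => h μ hμ ▸ hPc μ hμ, C, hC, fun μ hμ => ?_⟩
  rw [← h μ hμ]
  exact hP μ hμ

omit [DecidableEq d] in
/-- Rewriting the order. [folklore] -/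
theorem IsConc.of_eq (hP : IsConc d a P) (hab : a = b) : IsConc d b P := hab ▸ hP

/-! ### The profiles of `MikadoFlows` and their derivatives -/

section Profiles

variable {m : Type*} [Fintype m] [DecidableEq m] (T : TransverseDatum d m)
variable {f₀ : EuclideanSpace ℝ m → ℝ} {κ₀ a μ : ℝ}

/-- Second derivatives of pulled-back profiles:
`∂ᵢ∂ₗ (conc ∘ L) = ∑_{l'} A l l' ∑_{l''} A i l'' (conc_{a+2} (∂_{l''}∂_{l'} f₀)) ∘ L`. [folklore] -/
theorem partialDeriv_partialDeriv_pull_conc (hf : IsProfile f₀) (hμ : 1 ≤ μ) (κ₀ a : ℝ) (i l : d) :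
    Torus.partialDeriv i (Torus.partialDeriv l (T.pull (conc κ₀ a μ f₀))) = fun y =>
      ∑ l', (T.A l l' : ℝ) * ∑ l'', (T.A i l'' : ℝ) * T.pull (conc κ₀ (a + 1 + 1) μ (pd l'' (pd l' f₀))) y := by
  rw [partialDeriv_pull_conc T hf hμ κ₀ a l]
  funext y
  have h1 : ∀ l', Torus.IsContDiff 1 (T.pull (conc κ₀ (a + 1) μ (pd l' f₀))) := fun l' =>
    (isSmooth_pull_conc T (hf.pd l') hμ κ₀ (a + 1)).isContDiff (by simp)
  have h2 : ∀ l' ∈ Finset.univ, Torus.IsContDiff 1 (fun y => (T.A l l' : ℝ) * T.pull (conc κ₀ (a + 1) μ (pd l' f₀)) y) :=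
    fun l' _ => ((isSmooth_pull_conc T (hf.pd l') hμ κ₀ (a + 1)).smul _).isContDiff (by simp)
  rw [Torus.partialDeriv_finset_sum _ h2]
  refine Finset.sum_congr rfl fun l' _ => ?_
  rw [Torus.partialDeriv_const_mul_apply (h1 l'), partialDeriv_pull_conc T (hf.pd l') hμ κ₀ (a + 1) i]

end Profiles

section Instances

variable (x : Index d)

/-- `#(transverse slots) = d - 1`, as a real number. [folklore] -/
theorem card_slot_real : (Fintype.card (Slot x) : ℝ) = (Fintype.card d : ℝ) - 1 := by
  rw [card_slot]
  have : 1 ≤ Fintype.card d := Fintype.card_pos_iff.2 ⟨pivot x⟩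
  push_cast [Nat.cast_sub this]; ring

/-- **`ψ_x` is concentrated of order `(d-1)/2`**: `|ψ_x| ≲ μ^{(d-1)/2}`,
`‖ψ_x‖_{L^p} ≲ μ^{(d-1)(1/2-1/p)}` (CL22 Thm. 4.3 (2), `m = 0`). [cite: CheskidovLuo2022, Thm. 4.3 (2)] -/
theorem isConc_psi : IsConc d (((Fintype.card d : ℝ) - 1) / 2) (fun μ => psi x μ) :=
  (isConc_pull_conc x (isProfile_psi0 (datum x).c) (normConst (datum x).c) ((Fintype.card (Slot x) : ℝ) / 2)).of_eq
    (by rw [card_slot_real])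

/-- **`∂ₗψ_x` is concentrated of order `(d-1)/2 + 1`** (CL22 Thm. 4.3 (2), `m = 1`). [cite: CheskidovLuo2022, Thm. 4.3 (2)] -/
theorem isConc_partialDeriv_psi (l : d) :
    IsConc d (((Fintype.card d : ℝ) - 1) / 2 + 1) (fun μ => Torus.partialDeriv l (psi x μ)) := by
  have h : IsConc d (((Fintype.card d : ℝ) - 1) / 2 + 1) (fun μ y => ∑ l', ((datum x).A l l' : ℝ) *
      (datum x).pull (conc (normConst (datum x).c) ((Fintype.card (Slot x) : ℝ) / 2 + 1) μ (pd l' (psi0 (datum x).c))) y) := by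
    refine IsConc.sum _ fun l' _ => IsConc.const_mul ?_ _
    exact (isConc_pull_conc x ((isProfile_psi0 (datum x).c).pd l') (normConst (datum x).c)
      ((Fintype.card (Slot x) : ℝ) / 2 + 1)).of_eq (by rw [card_slot_real])
  refine h.congr fun μ hμ => ?_
  exact (partialDeriv_pull_conc (datum x) (isProfile_psi0 _) hμ _ _ l).symm

/-- **`∂ₗφ_x` is concentrated of order `(d-1)/2 - 1`** (one derivative of the potential of
order `-2`; CL22 Thm. 4.3 (2) for `Ω_k`). [cite: CheskidovLuo2022, Thm. 4.3 (2)] -/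
theorem isConc_partialDeriv_phi (l : d) :
    IsConc d (((Fintype.card d : ℝ) - 1) / 2 - 1) (fun μ => Torus.partialDeriv l (phi x μ)) := by
  have h : IsConc d (((Fintype.card d : ℝ) - 1) / 2 - 1) (fun μ y => ∑ l', ((datum x).A l l' : ℝ) *
      (datum x).pull (conc (normConst (datum x).c) ((Fintype.card (Slot x) : ℝ) / 2 - 2 + 1) μ (pd l' (phi0 (datum x).c))) y) := by
    refine IsConc.sum _ fun l' _ => IsConc.const_mul ?_ _
    exact (isConc_pull_conc x ((isProfile_phi0 (datum x).c).pd l') (normConst (datum x).c)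
      ((Fintype.card (Slot x) : ℝ) / 2 - 2 + 1)).of_eq (by rw [card_slot_real]; ring)
  refine h.congr fun μ hμ => ?_
  exact (partialDeriv_pull_conc (datum x) (isProfile_phi0 _) hμ _ _ l).symm

/-- **`∂ᵢ∂ₗφ_x` is concentrated of order `(d-1)/2`**. [cite: CheskidovLuo2022, Thm. 4.3 (2)] -/
theorem isConc_partialDeriv_partialDeriv_phi (i l : d) :
    IsConc d (((Fintype.card d : ℝ) - 1) / 2) (fun μ => Torus.partialDeriv i (Torus.partialDeriv l (phi x μ))) := by
  have h : IsConc d (((Fintype.card d : ℝ) - 1) / 2) (fun μ y => ∑ l', ((datum x).A l l' : ℝ) *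
      ∑ l'', ((datum x).A i l'' : ℝ) * (datum x).pull (conc (normConst (datum x).c)
        ((Fintype.card (Slot x) : ℝ) / 2 - 2 + 1 + 1) μ (pd l'' (pd l' (phi0 (datum x).c)))) y) := by
    refine IsConc.sum _ fun l' _ => IsConc.const_mul (IsConc.sum _ fun l'' _ => IsConc.const_mul ?_ _) _
    exact (isConc_pull_conc x (((isProfile_phi0 (datum x).c).pd l').pd l'') (normConst (datum x).c)
      ((Fintype.card (Slot x) : ℝ) / 2 - 2 + 1 + 1)).of_eq (by rw [card_slot_real]; ring)
  refine h.congr fun μ hμ => ?_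
  exact (partialDeriv_partialDeriv_pull_conc (datum x) (isProfile_phi0 _) hμ _ _ i l).symm

/-- **`∂ᵢ∂ₗΘ_x` is concentrated of order `(d-1)/2 - 2`** (second-generation potential). [cite: CheskidovLuo2022, Thm. 4.3 (2)] -/
theorem isConc_partialDeriv_partialDeriv_theta (i l : d) :
    IsConc d (((Fintype.card d : ℝ) - 1) / 2 - 2) (fun μ => Torus.partialDeriv i (Torus.partialDeriv l (theta x μ))) := by
  have h : IsConc d (((Fintype.card d : ℝ) - 1) / 2 - 2) (fun μ y => ∑ l', ((datum x).A l l' : ℝ) *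
      ∑ l'', ((datum x).A i l'' : ℝ) * (datum x).pull (conc (normConst (datum x).c)
        ((Fintype.card (Slot x) : ℝ) / 2 - 4 + 1 + 1) μ (pd l'' (pd l' (theta0 (Slot x))))) y) := by
    refine IsConc.sum _ fun l' _ => IsConc.const_mul (IsConc.sum _ fun l'' _ => IsConc.const_mul ?_ _) _
    exact (isConc_pull_conc x ((isProfile_theta0.pd l').pd l'') (normConst (datum x).c)
      ((Fintype.card (Slot x) : ℝ) / 2 - 4 + 1 + 1)).of_eq (by rw [card_slot_real]; ring)
  refine h.congr fun μ hμ => ?_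
  exact (partialDeriv_partialDeriv_pull_conc (datum x) isProfile_theta0 hμ _ _ i l).symm

end Instances

/-! ## The rescaled profile and its potentials -/

section Rescaled

/-- **The rescaled pipe profile** `ψ_x(σ·)` (CL22 (4.16): `𝐖_k(σx) = ψ_k(σx) k`). [cite: CheskidovLuo2022, §4.4 (4.16)] -/
def psiR (x : Index d) (μ : ℝ) (σ : ℕ) : UnitAddTorus d → ℝ := fun y => psi x μ (σ • y)

/-- **The rescaled potential** `σ⁻² φ_x(σ·)`, so that `Δ (phiR) = psiR` (CL22 (4.7), (4.17):
the corrector gains `σ⁻¹` through `∇(σ⁻²φ(σ·)) = σ⁻¹(∇φ)(σ·)`). [cite: CheskidovLuo2022, §4.4 (4.17)] -/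
def phiR (x : Index d) (μ : ℝ) (σ : ℕ) : UnitAddTorus d → ℝ := fun y => (((σ : ℝ)) ^ 2)⁻¹ * phi x μ (σ • y)

/-- **The second-layer potentials** `σ⁻³ (∂ⱼΘ_x)(σ·)`, so that `Δ (thetaR j) = ∂ⱼ (phiR)`
(one level below CL22's `φ_k`, used for the second-order expansion of `∂ₜw^{(p)}`). [folklore] -/
def thetaR (x : Index d) (μ : ℝ) (σ : ℕ) (j : d) : UnitAddTorus d → ℝ :=
  fun y => (((σ : ℝ)) ^ 3)⁻¹ * Torus.partialDeriv j (theta x μ) (σ • y)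

variable {x : Index d} {μ : ℝ} {σ : ℕ}

/-- `psiR` is smooth. [folklore] -/
theorem isSmooth_psiR (x : Index d) (hμ : 1 ≤ μ) (σ : ℕ) : Torus.IsSmooth (psiR x μ σ) :=
  isSmooth_comp_nsmul (isSmooth_psi x hμ) σ

/-- `phiR` is smooth. [folklore] -/
theorem isSmooth_phiR (x : Index d) (hμ : 1 ≤ μ) (σ : ℕ) : Torus.IsSmooth (phiR x μ σ) :=
  (isSmooth_comp_nsmul (isSmooth_phi x hμ) σ).smul _

/-- `thetaR j` is smooth. [folklore] -/
theorem isSmooth_thetaR (x : Index d) (hμ : 1 ≤ μ) (σ : ℕ) (j : d) : Torus.IsSmooth (thetaR x μ σ j) :=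
  (isSmooth_comp_nsmul ((isSmooth_theta x hμ).partialDeriv j) σ).smul _

/-- `∫ psiR² = 1` (`d ≥ 2`, `σ ≥ 1`). [folklore] -/
theorem integral_psiR_sq (hd : 2 ≤ Fintype.card d) (x : Index d) (hμ : 1 ≤ μ) (hσ : 0 < σ) :
    ∫ y, psiR x μ σ y ^ 2 = 1 :=
  (integral_comp_nsmul hσ (g := fun y => psi x μ y ^ 2) (((isSmooth_psi x hμ).continuous.pow 2).aestronglyMeasurable)).trans
    (integral_psi_sq hd x hμ)

/-- `∫ psiR = 0`. [folklore] -/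
theorem integral_psiR (x : Index d) (hμ : 1 ≤ μ) (hσ : 0 < σ) : ∫ y, psiR x μ σ y = 0 :=
  (integral_comp_nsmul hσ (g := psi x μ) (isSmooth_psi x hμ).continuous.aestronglyMeasurable).trans (integral_psi x hμ)

/-- **`Δ (phiR) = psiR`** (`σ ≥ 1`). [cite: CheskidovLuo2022, §4.1 (4.7)] -/
theorem laplacian_phiR (x : Index d) (hμ : 1 ≤ μ) (hσ : 0 < σ) (y : UnitAddTorus d) :
    Torus.laplacian (phiR x μ σ) y = psiR x μ σ y := by
  have hσ' : (σ : ℝ) ≠ 0 := by exact_mod_cast hσ.ne'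
  have h := isSmooth_comp_nsmul (isSmooth_phi x hμ) σ
  show Torus.laplacian ((((σ : ℝ)) ^ 2)⁻¹ • fun z => phi x μ (σ • z)) y = _
  rw [Torus.laplacian_const_smul_apply h, laplacian_comp_nsmul (isSmooth_phi x hμ), laplacian_phi x hμ, smul_smul,
    inv_mul_cancel₀ (pow_ne_zero 2 hσ'), one_smul]
  rfl

/-- `∂ₗ psiR (y) = σ (∂ₗψ_x)(σ•y)`. [folklore] -/
theorem partialDeriv_psiR (x : Index d) (μ : ℝ) (σ : ℕ) (l : d) (y : UnitAddTorus d) :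
    Torus.partialDeriv l (psiR x μ σ) y = (σ : ℝ) * Torus.partialDeriv l (psi x μ) (σ • y) := by
  unfold psiR
  rw [partialDeriv_comp_nsmul, smul_eq_mul]

/-- **`∂ₗ phiR (y) = σ⁻¹ (∂ₗφ_x)(σ•y)`** (the gain `σ⁻¹`). [cite: CheskidovLuo2022, §4.4 (4.17)] -/
theorem partialDeriv_phiR (x : Index d) (hμ : 1 ≤ μ) (hσ : 0 < σ) (l : d) (y : UnitAddTorus d) :
    Torus.partialDeriv l (phiR x μ σ) y = ((σ : ℝ))⁻¹ * Torus.partialDeriv l (phi x μ) (σ • y) := by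
  have hσ' : (σ : ℝ) ≠ 0 := by exact_mod_cast hσ.ne'
  have h1 : Torus.IsContDiff 1 (fun z => phi x μ (σ • z)) := (isSmooth_comp_nsmul (isSmooth_phi x hμ) σ).isContDiff (by simp)
  unfold phiR
  rw [Torus.partialDeriv_const_mul_apply h1, partialDeriv_comp_nsmul, smul_eq_mul]
  field_simp

/-- `∇ phiR (y) = σ⁻¹ (∇φ_x)(σ•y)`. [folklore] -/
theorem gradient_phiR (x : Index d) (hμ : 1 ≤ μ) (hσ : 0 < σ) (y : UnitAddTorus d) :
    Torus.gradient (phiR x μ σ) y = ((σ : ℝ))⁻¹ • Torus.gradient (phi x μ) (σ • y) := by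
  have hσ' : (σ : ℝ) ≠ 0 := by exact_mod_cast hσ.ne'
  have h := isSmooth_comp_nsmul (isSmooth_phi x hμ) σ
  show Torus.gradient ((((σ : ℝ)) ^ 2)⁻¹ • fun z => phi x μ (σ • z)) y = _
  rw [Torus.gradient_const_smul (h.isContDiff (by simp)), gradient_comp_nsmul (isSmooth_phi x hμ), smul_smul]
  congr 1
  field_simp

/-- `∂ᵢ∂ₗ phiR (y) = (∂ᵢ∂ₗφ_x)(σ•y)`. [folklore] -/
theorem partialDeriv_partialDeriv_phiR (x : Index d) (hμ : 1 ≤ μ) (hσ : 0 < σ) (i l : d) (y : UnitAddTorus d) :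
    Torus.partialDeriv i (Torus.partialDeriv l (phiR x μ σ)) y =
      Torus.partialDeriv i (Torus.partialDeriv l (phi x μ)) (σ • y) := by
  have hσ' : (σ : ℝ) ≠ 0 := by exact_mod_cast hσ.ne'
  have e : Torus.partialDeriv l (phiR x μ σ) = fun z => ((σ : ℝ))⁻¹ * Torus.partialDeriv l (phi x μ) (σ • z) :=
    funext (partialDeriv_phiR x hμ hσ l)
  have h1 : Torus.IsContDiff 1 (fun z => Torus.partialDeriv l (phi x μ) (σ • z)) :=
    (isSmooth_comp_nsmul ((isSmooth_phi x hμ).partialDeriv l) σ).isContDiff (by simp)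
  rw [e, Torus.partialDeriv_const_mul_apply h1, partialDeriv_comp_nsmul, smul_eq_mul, ← mul_assoc,
    inv_mul_cancel₀ hσ', one_mul]

/-- **`Δ (thetaR j) = ∂ⱼ phiR`** (`σ ≥ 1`; `ΔΘ_x = φ_x` and `∂ⱼΔ = Δ∂ⱼ`). [folklore] -/
theorem laplacian_thetaR (x : Index d) (hμ : 1 ≤ μ) (hσ : 0 < σ) (j : d) (y : UnitAddTorus d) :
    Torus.laplacian (thetaR x μ σ j) y = Torus.partialDeriv j (phiR x μ σ) y := by
  have hσ' : (σ : ℝ) ≠ 0 := by exact_mod_cast hσ.ne'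
  have hΘ := isSmooth_theta x hμ
  have h := isSmooth_comp_nsmul (hΘ.partialDeriv j) σ
  show Torus.laplacian ((((σ : ℝ)) ^ 3)⁻¹ • fun z => Torus.partialDeriv j (theta x μ) (σ • z)) y = _
  rw [Torus.laplacian_const_smul_apply h, laplacian_comp_nsmul (hΘ.partialDeriv j), ← Torus.partialDeriv_laplacian_comm hΘ,
    laplacian_theta x hμ, partialDeriv_phiR x hμ hσ, smul_smul, smul_eq_mul]
  congr 1
  field_simp

/-- `∂ᵢ (thetaR j) (y) = σ⁻² (∂ᵢ∂ⱼΘ_x)(σ•y)`. [folklore] -/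
theorem partialDeriv_thetaR (x : Index d) (hμ : 1 ≤ μ) (hσ : 0 < σ) (i j : d) (y : UnitAddTorus d) :
    Torus.partialDeriv i (thetaR x μ σ j) y =
      (((σ : ℝ)) ^ 2)⁻¹ * Torus.partialDeriv i (Torus.partialDeriv j (theta x μ)) (σ • y) := by
  have hσ' : (σ : ℝ) ≠ 0 := by exact_mod_cast hσ.ne'
  have h1 : Torus.IsContDiff 1 (fun z => Torus.partialDeriv j (theta x μ) (σ • z)) :=
    (isSmooth_comp_nsmul ((isSmooth_theta x hμ).partialDeriv j) σ).isContDiff (by simp)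
  unfold thetaR
  rw [Torus.partialDeriv_const_mul_apply h1, partialDeriv_comp_nsmul, smul_eq_mul]
  field_simp

/-- **`(k_x·∇) psiR = 0`**. [cite: CheskidovLuo2022, Thm. 4.3 (1)] -/
theorem dirD_psiR (x : Index d) (hμ : 1 ≤ μ) (σ : ℕ) (y : UnitAddTorus d) : dirD x (psiR x μ σ) y = 0 := by
  unfold psiR
  rw [dirD_comp_nsmul, dirD_psi x hμ, mul_zero]

/-- **`(k_x·∇) ∂ᵢ phiR = 0`**. [folklore] -/
theorem dirD_partialDeriv_phiR (x : Index d) (hμ : 1 ≤ μ) (hσ : 0 < σ) (i : d) (y : UnitAddTorus d) :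
    dirD x (Torus.partialDeriv i (phiR x μ σ)) y = 0 := by
  have e : Torus.partialDeriv i (phiR x μ σ) = fun z => ((σ : ℝ))⁻¹ * Torus.partialDeriv i (phi x μ) (σ • z) :=
    funext (partialDeriv_phiR x hμ hσ i)
  have h1 : Torus.IsContDiff 1 (fun z => Torus.partialDeriv i (phi x μ) (σ • z)) :=
    (isSmooth_comp_nsmul ((isSmooth_phi x hμ).partialDeriv i) σ).isContDiff (by simp)
  rw [e, dirD_const_mul x h1, dirD_comp_nsmul, dirD_partialDeriv_phi x hμ i, mul_zero, mul_zero]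

omit [DecidableEq d] in
/-- **`L^p` norms are invariant under `y ↦ σ • y`** (`σ ≥ 1`; Haar invariance). [folklore] -/
theorem eLpNorm_comp_nsmul {F : Type*} [NormedAddCommGroup F] {f : UnitAddTorus d → F}
    (hf : AEStronglyMeasurable f volume) (hσ : 0 < σ) (p : ℝ≥0∞) :
    eLpNorm (fun y => f (σ • y)) p volume = eLpNorm f p volume :=
  eLpNorm_comp_measurePreserving hf (measurePreserving_nsmul_unitAddTorus hσ)

end Rescaled

/-! ## The oscillation potential `σ⁻² Δ⁻¹(ψ_x² - 1)(σ·)` and the Green pairing -/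

section Oscillation

variable {x : Index d} {μ : ℝ} {σ : ℕ}

/-- The fluctuation `ψ_x² - 1` of the squared profile about its mean (CL22 §4.5:
`𝐖_k ⊗ 𝐖_k - ⨍ 𝐖_k ⊗ 𝐖_k = (ψ_k² - 1) k ⊗ k`). [cite: CheskidovLuo2022, §4.5] -/
def fluct (x : Index d) (μ : ℝ) : UnitAddTorus d → ℝ := fun y => psi x μ y ^ 2 - 1

/-- `ψ_x² - 1` is smooth. [folklore] -/
theorem isSmooth_fluct (x : Index d) (hμ : 1 ≤ μ) : Torus.IsSmooth (fluct x μ) := by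
  have h := isSmooth_psi x hμ
  have h2 : Torus.IsSmooth (fun y => psi x μ y ^ 2) := h.pow 2
  exact h2.sub (Torus.isSmooth_const _)

/-- `∫ (ψ_x² - 1) = 0` (`d ≥ 2`). [folklore] -/
theorem integral_fluct (hd : 2 ≤ Fintype.card d) (x : Index d) (hμ : 1 ≤ μ) : ∫ y, fluct x μ y = 0 := by
  have hi : Integrable (fun y => psi x μ y ^ 2) volume := ((isSmooth_psi x hμ).continuous.pow 2).integrable_unitAddTorus
  unfold fluct
  rw [integral_sub hi (integrable_const _), integral_psi_sq hd x hμ]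
  simp

/-- **`∫ (ψ_x² - 1)² ≤ (sup|ψ_x|)²`** (`∫ψ⁴ ≤ sup ψ² ∫ψ² = sup ψ²`). [folklore] -/
theorem integral_sq_fluct_le (hd : 2 ≤ Fintype.card d) (x : Index d) (hμ : 1 ≤ μ) {B : ℝ}
    (hB : ∀ y, |psi x μ y| ≤ B) : ∫ y, fluct x μ y ^ 2 ≤ B ^ 2 := by
  have hψ := (isSmooth_psi x hμ).continuous
  have h1 : ∀ y, fluct x μ y ^ 2 ≤ (B ^ 2 - 2) * psi x μ y ^ 2 + 1 := by
    intro y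
    have hb := hB y
    have h2 : psi x μ y ^ 2 ≤ B ^ 2 := by
      rw [← sq_abs]; exact pow_le_pow_left₀ (abs_nonneg _) hb 2
    have : fluct x μ y ^ 2 = psi x μ y ^ 2 * psi x μ y ^ 2 - 2 * psi x μ y ^ 2 + 1 := by simp only [fluct]; ring
    rw [this]
    nlinarith [sq_nonneg (psi x μ y)]
  have hi1 : Integrable (fun y => fluct x μ y ^ 2) volume := ((isSmooth_fluct x hμ).continuous.pow 2).integrable_unitAddTorus
  have hi0 : Integrable (fun y => psi x μ y ^ 2) volume := (hψ.pow 2).integrable_unitAddTorus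
  have hi3 : Integrable (fun y => (B ^ 2 - 2) * psi x μ y ^ 2) volume := hi0.const_mul _
  have hi2 : Integrable (fun y => (B ^ 2 - 2) * psi x μ y ^ 2 + 1) volume := hi3.add (integrable_const _)
  have e2 : ∫ y, ((B ^ 2 - 2) * psi x μ y ^ 2 + 1) = (B ^ 2 - 2) * 1 + 1 := by
    rw [integral_add hi3 (integrable_const _), integral_const_mul, integral_psi_sq hd x hμ, integral_const]
    simp
  calc ∫ y, fluct x μ y ^ 2 ≤ ∫ y, ((B ^ 2 - 2) * psi x μ y ^ 2 + 1) := integral_mono hi1 hi2 h1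
    _ = (B ^ 2 - 2) * 1 + 1 := e2
    _ ≤ B ^ 2 := by linarith

/-- **The oscillation potential** `σ⁻² (Δ⁻¹(ψ_x² - 1))(σ·)` (`Δ⁻¹` of `TorusInverseLaplacian`;
CL22 §4.5 handles this term with the bilinear antidivergence `𝓑` of Thm. 7.4). [cite: CheskidovLuo2022, §4.5] -/
def oscPot (x : Index d) (μ : ℝ) (σ : ℕ) : UnitAddTorus d → ℝ :=
  fun y => (((σ : ℝ)) ^ 2)⁻¹ * Torus.invLaplacian (fluct x μ) (σ • y)

/-- `oscPot` is smooth. [folklore] -/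
theorem isSmooth_oscPot (x : Index d) (hμ : 1 ≤ μ) (σ : ℕ) : Torus.IsSmooth (oscPot x μ σ) :=
  (isSmooth_comp_nsmul (Torus.isSmooth_invLaplacian (isSmooth_fluct x hμ)) σ).smul _

/-- **`Δ (oscPot) = psiR² - 1`** (`d ≥ 2`, `σ ≥ 1`; `Δ Δ⁻¹ F = F - ∫F` and `∫F = 0`). [folklore] -/
theorem laplacian_oscPot (hd : 2 ≤ Fintype.card d) (x : Index d) (hμ : 1 ≤ μ) (hσ : 0 < σ) (y : UnitAddTorus d) :
    Torus.laplacian (oscPot x μ σ) y = psiR x μ σ y ^ 2 - 1 := by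
  haveI : Nonempty d := Fintype.card_pos_iff.1 (by omega)
  have hσ' : (σ : ℝ) ≠ 0 := by exact_mod_cast hσ.ne'
  have hF := isSmooth_fluct x hμ
  have hG := Torus.isSmooth_invLaplacian hF
  show Torus.laplacian ((((σ : ℝ)) ^ 2)⁻¹ • fun z => Torus.invLaplacian (fluct x μ) (σ • z)) y = _
  rw [Torus.laplacian_const_smul_apply (isSmooth_comp_nsmul hG σ), laplacian_comp_nsmul hG,
    Torus.laplacian_invLaplacian hF, integral_fluct hd x hμ, smul_smul, inv_mul_cancel₀ (pow_ne_zero 2 hσ'), one_smul,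
    sub_zero]
  rfl

/-- `∂ₗ (oscPot) (y) = σ⁻¹ (∂ₗ Δ⁻¹(ψ_x² - 1))(σ•y)`. [folklore] -/
theorem partialDeriv_oscPot (x : Index d) (hμ : 1 ≤ μ) (hσ : 0 < σ) (l : d) (y : UnitAddTorus d) :
    Torus.partialDeriv l (oscPot x μ σ) y =
      ((σ : ℝ))⁻¹ * Torus.partialDeriv l (Torus.invLaplacian (fluct x μ)) (σ • y) := by
  have hσ' : (σ : ℝ) ≠ 0 := by exact_mod_cast hσ.ne'
  have hG := Torus.isSmooth_invLaplacian (isSmooth_fluct x hμ)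
  have h1 : Torus.IsContDiff 1 (fun z => Torus.invLaplacian (fluct x μ) (σ • z)) := (isSmooth_comp_nsmul hG σ).isContDiff (by simp)
  unfold oscPot
  rw [Torus.partialDeriv_const_mul_apply h1, partialDeriv_comp_nsmul, smul_eq_mul]
  field_simp

/-- `∇ (oscPot) (y) = σ⁻¹ (∇Δ⁻¹(ψ_x² - 1))(σ•y)`. [folklore] -/
theorem gradient_oscPot (x : Index d) (hμ : 1 ≤ μ) (hσ : 0 < σ) (y : UnitAddTorus d) :
    Torus.gradient (oscPot x μ σ) y = ((σ : ℝ))⁻¹ • Torus.gradient (Torus.invLaplacian (fluct x μ)) (σ • y) := by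
  have hσ' : (σ : ℝ) ≠ 0 := by exact_mod_cast hσ.ne'
  have hG := Torus.isSmooth_invLaplacian (isSmooth_fluct x hμ)
  show Torus.gradient ((((σ : ℝ)) ^ 2)⁻¹ • fun z => Torus.invLaplacian (fluct x μ) (σ • z)) y = _
  rw [Torus.gradient_const_smul ((isSmooth_comp_nsmul hG σ).isContDiff (by simp)), gradient_comp_nsmul hG, smul_smul]
  congr 1
  field_simp

/-- `L²` size of `∇Δ⁻¹(ψ_x² - 1)`: `∫ (∂ₗΔ⁻¹(ψ² - 1))² ≤ (2π)⁻² (sup|ψ|)²`. [folklore] -/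
theorem integral_sq_partialDeriv_invLaplacian_fluct_le (hd : 2 ≤ Fintype.card d) (x : Index d) (hμ : 1 ≤ μ)
    {B : ℝ} (hB : ∀ y, |psi x μ y| ≤ B) (l : d) :
    ∫ y, Torus.partialDeriv l (Torus.invLaplacian (fluct x μ)) y ^ 2 ≤ ((2 * Real.pi)⁻¹) ^ 2 * B ^ 2 := by
  haveI : Nonempty d := Fintype.card_pos_iff.1 (by omega)
  exact (Torus.integral_sq_partialDeriv_invLaplacian_le (isSmooth_fluct x hμ) l).trans
    (mul_le_mul_of_nonneg_left (integral_sq_fluct_le hd x hμ hB) (sq_nonneg _))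

/-- `L²` size of `Δ⁻¹(ψ_x² - 1)`: `∫ (Δ⁻¹(ψ² - 1))² ≤ (4π²)⁻² (sup|ψ|)²`. [folklore] -/
theorem integral_sq_invLaplacian_fluct_le (hd : 2 ≤ Fintype.card d) (x : Index d) (hμ : 1 ≤ μ)
    {B : ℝ} (hB : ∀ y, |psi x μ y| ≤ B) :
    ∫ y, Torus.invLaplacian (fluct x μ) y ^ 2 ≤ ((4 * Real.pi ^ 2)⁻¹) ^ 2 * B ^ 2 := by
  haveI : Nonempty d := Fintype.card_pos_iff.1 (by omega)
  exact (Torus.integral_sq_invLaplacian_le (isSmooth_fluct x hμ)).trans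
    (mul_le_mul_of_nonneg_left (integral_sq_fluct_le hd x hμ hB) (sq_nonneg _))

omit [DecidableEq d] in
/-- Cauchy–Schwarz on the probability torus: `∫|h| ≤ (∫h²)^{1/2}` (from `0 ≤ ∫(|h| - ∫|h|)²`). [folklore] -/
theorem integral_abs_le_sqrt_integral_sq {h : UnitAddTorus d → ℝ} (hh : Continuous h) :
    ∫ y, |h y| ≤ Real.sqrt (∫ y, h y ^ 2) := by
  set m := ∫ y, |h y| with hm
  have hm0 : 0 ≤ m := integral_nonneg fun _ => abs_nonneg _
  have hi1 : Integrable (fun y => |h y|) volume := hh.abs.integrable_unitAddTorus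
  have hi2 : Integrable (fun y => h y ^ 2) volume := (hh.pow 2).integrable_unitAddTorus
  have key : m ^ 2 ≤ ∫ y, h y ^ 2 := by
    have h0 : 0 ≤ ∫ y, (|h y| - m) ^ 2 := integral_nonneg fun _ => sq_nonneg _
    have e1 : (fun y => (|h y| - m) ^ 2) = fun y => (h y ^ 2 - (2 * m) * |h y|) + m ^ 2 := by
      funext y; rw [sub_sq, sq_abs]; ring
    have hi3 : Integrable (fun y => (2 * m) * |h y|) volume := hi1.const_mul _
    have hi4 : Integrable (fun y => h y ^ 2 - (2 * m) * |h y|) volume := hi2.sub hi3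
    rw [e1, integral_add hi4 (integrable_const _), integral_sub hi2 hi3, integral_const_mul, integral_const] at h0
    simp only [smul_eq_mul, probReal_univ, one_mul] at h0
    nlinarith
  have := Real.abs_le_sqrt key
  rwa [abs_of_nonneg hm0] at this

/-- **The Green pairing against a rescaled zero-mean function**:
`∫ b(y) F(σ•y) dy = σ⁻² ∫ Δb(y) (Δ⁻¹F)(σ•y) dy` for smooth `b`, `F` with `∫F = 0` and `σ ≥ 1`
(`F(σ·) = Δ[σ⁻²(Δ⁻¹F)(σ·)]` and Green's second identity on `𝕋^d`; the `p = 2` substitute for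
CL22 Lemma 7.1 / Thm. 7.4 in the energy estimate). [cite: CheskidovLuo2022, §7 Lemma 7.1] -/
theorem integral_mul_comp_nsmul (hd : 2 ≤ Fintype.card d) {b F : UnitAddTorus d → ℝ} (hb : Torus.IsSmooth b)
    (hF : Torus.IsSmooth F) (hF0 : ∫ y, F y = 0) (hσ : 0 < σ) :
    ∫ y, b y * F (σ • y) = (((σ : ℝ)) ^ 2)⁻¹ * ∫ y, Torus.laplacian b y * Torus.invLaplacian F (σ • y) := by
  haveI : Nonempty d := Fintype.card_pos_iff.1 (by omega)
  have hσ' : (σ : ℝ) ≠ 0 := by exact_mod_cast hσ.ne'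
  have hG := Torus.isSmooth_invLaplacian hF
  have hGσ : Torus.IsSmooth ((((σ : ℝ)) ^ 2)⁻¹ • fun z => Torus.invLaplacian F (σ • z)) :=
    (isSmooth_comp_nsmul hG σ).smul _
  have hΔ : ∀ y, Torus.laplacian ((((σ : ℝ)) ^ 2)⁻¹ • fun z => Torus.invLaplacian F (σ • z)) y = F (σ • y) := by
    intro y
    rw [Torus.laplacian_const_smul_apply (isSmooth_comp_nsmul hG σ), laplacian_comp_nsmul hG,
      Torus.laplacian_invLaplacian hF, hF0, smul_smul, inv_mul_cancel₀ (pow_ne_zero 2 hσ'), one_smul, sub_zero]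
  calc ∫ y, b y * F (σ • y)
      = ∫ y, b y * Torus.laplacian ((((σ : ℝ)) ^ 2)⁻¹ • fun z => Torus.invLaplacian F (σ • z)) y := by
        simp_rw [hΔ]
    _ = ∫ y, Torus.laplacian b y * ((((σ : ℝ)) ^ 2)⁻¹ • fun z => Torus.invLaplacian F (σ • z)) y :=
        Torus.integral_mul_laplacian_comm_holds hb hGσ
    _ = (((σ : ℝ)) ^ 2)⁻¹ * ∫ y, Torus.laplacian b y * Torus.invLaplacian F (σ • y) := by
        rw [← integral_const_mul]
        refine integral_congr_ae (Eventually.of_forall fun y => ?_)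
        simp only [Pi.smul_apply, smul_eq_mul]; ring

/-- **The Green pairing bound** `|∫ b F(σ•·)| ≤ σ⁻² sup|Δb| (∫(Δ⁻¹F)²)^{1/2}`. [cite: CheskidovLuo2022, §7 Lemma 7.1] -/
theorem abs_integral_mul_comp_nsmul_le (hd : 2 ≤ Fintype.card d) {b F : UnitAddTorus d → ℝ} (hb : Torus.IsSmooth b)
    (hF : Torus.IsSmooth F) (hF0 : ∫ y, F y = 0) (hσ : 0 < σ) {K : ℝ} (hK : ∀ y, |Torus.laplacian b y| ≤ K) :
    |∫ y, b y * F (σ • y)| ≤ (((σ : ℝ)) ^ 2)⁻¹ * K * Real.sqrt (∫ y, Torus.invLaplacian F y ^ 2) := by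
  have hG := Torus.isSmooth_invLaplacian hF
  have hK0 : 0 ≤ K := (abs_nonneg _).trans (hK 0)
  rw [integral_mul_comp_nsmul hd hb hF hF0 hσ, abs_mul, abs_of_nonneg (by positivity), mul_assoc]
  refine mul_le_mul_of_nonneg_left ?_ (by positivity)
  have hGσc : Continuous fun y => Torus.invLaplacian F (σ • y) := (isSmooth_comp_nsmul hG σ).continuous
  have hi : Integrable (fun y => K * |Torus.invLaplacian F (σ • y)|) volume := (hGσc.abs.const_mul K).integrable_unitAddTorus
  calc |∫ y, Torus.laplacian b y * Torus.invLaplacian F (σ • y)|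
      ≤ ∫ y, |Torus.laplacian b y * Torus.invLaplacian F (σ • y)| := abs_integral_le_integral_abs
    _ ≤ ∫ y, K * |Torus.invLaplacian F (σ • y)| := by
        refine integral_mono_of_nonneg (Eventually.of_forall fun _ => abs_nonneg _) hi (Eventually.of_forall fun y => ?_)
        beta_reduce
        rw [abs_mul]
        exact mul_le_mul_of_nonneg_right (hK y) (abs_nonneg _)
    _ = K * ∫ y, |Torus.invLaplacian F y| := by
        rw [integral_const_mul, integral_comp_nsmul hσ (g := fun y => |Torus.invLaplacian F y|) hG.continuous.abs.aestronglyMeasurable]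
    _ ≤ K * Real.sqrt (∫ y, Torus.invLaplacian F y ^ 2) :=
        mul_le_mul_of_nonneg_left (integral_abs_le_sqrt_integral_sq hG.continuous) hK0

end Oscillation

end Conc

end Mikado

end Literature.Analysis.FluidPDE
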